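import Mathlib.Geometry.Manifold.MFDeriv.Atlas
import Mathlib.Analysis.Analytic.Polynomial
import Literature.AlgebraicGeometry.HodgeTheory.HypersurfaceResidueFormDef
import Literature.Analysis.Complex.OsgoodProofs
import Literature.Geometry.Kaehler.KaehlerProofs
import HarnessLib

/-!
# The residue form of a projective hypersurface is holomorphic in charts

Family `hodge`, layer `Literature/AlgebraicGeometry/HodgeTheory`. Step S4 of the programme proving
the named fact `Voisin2003_hypersurface_residueForm` (file `HypersurfaceResidueForms`): the
complex `m`-form `residueForm ψ F P = ψ^* Res_Y(PΩ/F)` of `HypersurfaceResidueFormDef` is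
**holomorphic in charts** (`Literature.Geometry.Kaehler.IsHolomorphicInCharts`,
file `Geometry/Kaehler/HolomorphicChartForms`) on a complex manifold `M` with holomorphic atlas
charted on the finite-dimensional `E` — `isHolomorphicInCharts_residueForm`, PROVED. With the local
formula `residueForm_eventuallyEq` (fixed admissible indices `(i, j)` near `x₀`), the chart
representative at `y` near the centre of the chart at `x₀` is

  `P(Z y) · det(N(Z y), Z y, D Z(y) ·)`,  `Z = Z̃_i ∘ chart_{x₀}⁻¹`,

because the pull-back factor `dZ̃_i(x) ∘ (tangent coordinate change)` is the derivative of `Z` at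
`y` (chain rule, `liftDeriv_comp_tangentCoordChange`; on a holomorphic atlas the real tangent
coordinate change is the complex one, `Literature.Geometry.Kaehler.tangentCoordChange_eq_restrictScalars`
of `KaehlerProofs`). This is a complex-analytic function of `y`: `Z` is holomorphic (the affine
coordinates are) hence analytic by Osgood's lemma
(`Literature.Analysis.Complex.SCV.analyticAt_of_differentiableOn`, several complex variables,
PROVED in the tree), `D Z` is analytic, polynomials are analytic (Mathlib
`AnalyticOnNhd.eval_mvPolynomial`), and the cone residue is bilinear in `(N, z)` and polynomial
in the linear map (`contDiffAt_coneResidue`, through the coordinate expansion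
`coneResidueId_eq_sum` and
`Literature.NumberTheory.Transcendental.ContDiffAt.continuousAlternatingMapCompContinuousLinearMap`).
In print this is the statement that `Res_Y(PΩ/F)` is a holomorphic form (Voisin II, §6.1.1:
`Res : Ω^n_X(log Y) → Ω^{n-1}_Y`).

## References

* C. Voisin, *Hodge Theory and Complex Algebraic Geometry II* (2003), §6.1.1, §6.1.3.
* K. Fritzsche, H. Grauert, *From Holomorphic Functions to Complex Manifolds* (2002), Ch. I
  (Osgood's lemma).
-/

noncomputable section

open scoped Manifold ContDiff Topology LinearAlgebra.Projectivization
open Set Filter Projectivization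

namespace Literature.AlgebraicGeometry.HodgeTheory

open Literature.NumberTheory.Transcendental Literature.Geometry.Kaehler

/-! ### Chart calculus on a holomorphic atlas -/

section Charts

variable {E : Type*} [NormedAddCommGroup E] [NormedSpace ℂ E]
  {M : Type*} [TopologicalSpace M] [ChartedSpace E M]
  {V : Type*} [NormedAddCommGroup V] [NormedSpace ℂ V]

/-- The vector-valued manifold derivative of a differentiable map into a vector space is the
Fréchet derivative of its reading in the preferred chart. [folklore] -/
theorem mvfderiv_eq_fderiv_comp_symm {f : M → V} {x : M}
    (hf : MDifferentiableAt 𝓘(ℂ, E) 𝓘(ℂ, V) f x) :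
    (show E →L[ℂ] V from mvfderiv 𝓘(ℂ, E) f x) =
      fderiv ℂ (f ∘ (extChartAt 𝓘(ℂ, E) x).symm) (extChartAt 𝓘(ℂ, E) x x) := by
  ext v
  change mvfderiv 𝓘(ℂ, E) f x v = _
  simp only [mvfderiv, ContinuousLinearMap.coe_comp, Function.comp_apply, hf.mfderiv,
    writtenInExtChartAt, extChartAt_model_space_eq_id, PartialEquiv.refl_coe,
    ModelWithCorners.Boundaryless.range_eq_univ, fderivWithin_univ]
  rfl

end Charts

/-! ### The cone residue: pull-backs and smooth dependence on parameters -/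

section Cone

variable {m : ℕ} {E : Type*} [NormedAddCommGroup E] [NormedSpace ℂ E]

/-- Pulling back the lift differential pulls back the cone residue form. [folklore] -/
theorem coneResidue_comp (N z : Fin (m + 2) → ℂ) (L : E →L[ℂ] (Fin (m + 2) → ℂ)) (T : E →L[ℂ] E) :
    coneResidue N z (L.comp T) = (coneResidue N z L).compContinuousLinearMap T := by
  ext v
  simp [coneResidue_apply]

/-- Restriction of scalars commutes with pull-back of alternating forms. [folklore] -/
theorem restrictScalars_compContinuousLinearMap (A : E [⋀^Fin m]→L[ℂ] ℂ) (T : E →L[ℂ] E) :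
    (A.compContinuousLinearMap T).restrictScalars ℝ =
      (A.restrictScalars ℝ).compContinuousLinearMap (T.restrictScalars ℝ) := by
  ext v
  simp

/-- Pull-back of alternating forms is linear. [folklore] -/
theorem smul_compContinuousLinearMap (c : ℂ) (A : E [⋀^Fin m]→L[ℂ] ℂ) (T : E →L[ℂ] E) :
    (c • A).compContinuousLinearMap T = c • A.compContinuousLinearMap T := by
  ext v; simp

/-- The cone residue form is additive in the cone point `z`. [folklore] -/
theorem coneResidue_add_mid (N z z' : Fin (m + 2) → ℂ) (L : E →L[ℂ] (Fin (m + 2) → ℂ)) :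
    coneResidue N (z + z') L = coneResidue N z L + coneResidue N z' L := by
  ext v
  rw [ContinuousAlternatingMap.add_apply, coneResidue_eq_coneA, coneResidue_eq_coneA,
    coneResidue_eq_coneA, coneA_apply, coneA_apply, coneA_apply]
  exact (coneB N).toMultilinearMap.cons_add _ z z'

/-- The cone residue on `ℂ^{m+2}` itself (pull-back along the identity): the continuous
(normed) counterpart of the algebraic `coneA N z` of `HypersurfaceConeResidue`
(`coneResidueId N z w = coneA N z w` definitionally), needed because `ContDiffAt` statements live
on the normed type of continuous alternating maps. [folklore] -/
def coneResidueId (N z : Fin (m + 2) → ℂ) : (Fin (m + 2) → ℂ) [⋀^Fin m]→L[ℂ] ℂ :=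
  coneResidue N z (ContinuousLinearMap.id ℂ (Fin (m + 2) → ℂ))

/-- `coneResidue N z L` is `coneResidueId N z` pulled back along `L`. [folklore] -/
theorem coneResidue_eq_coneResidueId_comp (N z : Fin (m + 2) → ℂ) (L : E →L[ℂ] (Fin (m + 2) → ℂ)) :
    coneResidue N z L = (coneResidueId N z).compContinuousLinearMap L := by
  ext v; simp [coneResidueId, coneResidue_apply]

/-- The cone residue as an (algebraic) bilinear map in `(N, z)`. [folklore] -/
def coneResidueBilₗ : (Fin (m + 2) → ℂ) →ₗ[ℂ] (Fin (m + 2) → ℂ) →ₗ[ℂ]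
    ((Fin (m + 2) → ℂ) [⋀^Fin m]→L[ℂ] ℂ) :=
  LinearMap.mk₂ ℂ (fun N z ↦ coneResidueId (m := m) N z)
    (fun N N' z ↦ coneResidue_add_left N N' z _)
    (fun c N z ↦ coneResidue_smul_left c N z _)
    (fun N z z' ↦ coneResidue_add_mid N z z' _)
    (fun c N z ↦ coneResidue_smul_mid c N z _)

/-- **Coordinate expansion** of the bilinear cone residue:
`Res(N, z) = Σ_{a,b} N_a z_b Res(e_a, e_b)`. [folklore] -/
theorem coneResidueId_eq_sum (N z : Fin (m + 2) → ℂ) :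
    coneResidueId (m := m) N z =
      ∑ a, ∑ b, (N a * z b) • coneResidueId (m := m) (Pi.single a 1) (Pi.single b 1) := by
  have hN := pi_eq_sum_univ' N
  have hz := pi_eq_sum_univ' z
  change coneResidueBilₗ (m := m) N z =
    ∑ a, ∑ b, (N a * z b) • coneResidueBilₗ (m := m) (Pi.single a 1) (Pi.single b 1)
  conv_lhs => rw [hN, hz]
  simp only [map_sum, map_smul, LinearMap.sum_apply, LinearMap.smul_apply, Finset.smul_sum,
    smul_smul]
  rw [Finset.sum_comm]
  exact Finset.sum_congr rfl fun a _ ↦ Finset.sum_congr rfl fun b _ ↦ by rw [mul_comm]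

variable {X : Type*} [NormedAddCommGroup X] [NormedSpace ℂ X]

/-- **Smooth (analytic) dependence of the cone residue on its parameters**: if `N`, `Z` and the
linear map `L` depend `C^n`-smoothly on `y` (any `n`, in particular `ω` = analytically), so does
`coneResidue (N y) (Z y) (L y)` — bilinear in `(N, Z)` by the coordinate expansion, polynomial in
`L` by `Literature.NumberTheory.Transcendental.ContDiffAt.continuousAlternatingMapCompContinuousLinearMap`.
[folklore] -/
theorem contDiffAt_coneResidue {N Z : X → Fin (m + 2) → ℂ} {L : X → E →L[ℂ] (Fin (m + 2) → ℂ)}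
    {y : X} {n : WithTop ℕ∞} (hN : ContDiffAt ℂ n N y) (hZ : ContDiffAt ℂ n Z y)
    (hL : ContDiffAt ℂ n L y) :
    ContDiffAt ℂ n (fun y ↦ coneResidue (N y) (Z y) (L y)) y := by
  have h1 : ContDiffAt ℂ n (fun y ↦ coneResidueId (m := m) (N y) (Z y)) y := by
    have heq : (fun y ↦ coneResidueId (m := m) (N y) (Z y)) = fun y ↦
        ∑ a, ∑ b, (N y a * Z y b) • coneResidueId (m := m) (Pi.single a 1) (Pi.single b 1) := by
      funext y; exact coneResidueId_eq_sum (N y) (Z y)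
    rw [heq]
    refine ContDiffAt.sum fun a _ ↦ ContDiffAt.sum fun b _ ↦ ?_
    have hab : ContDiffAt ℂ n (fun y ↦ N y a * Z y b) y :=
      ((contDiffAt_pi.mp hN) a).mul ((contDiffAt_pi.mp hZ) b)
    exact hab.smul contDiffAt_const
  have h2 := Literature.NumberTheory.Transcendental.ContDiffAt.continuousAlternatingMapCompContinuousLinearMap h1 hL
  simpa [coneResidue_eq_coneResidueId_comp] using h2

end Cone

/-! ### The lifts read in a chart, and the main theorem -/

section Main

variable {m : ℕ} {E : Type*} [NormedAddCommGroup E] [NormedSpace ℂ E] [FiniteDimensional ℂ E]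
  {M : Type*} [TopologicalSpace M] [ChartedSpace E M] [IsManifold 𝓘(ℂ, E) ω M]
  (ψ : M → ℙ ℂ (Fin (m + 2) → ℂ)) {F : MvPolynomial (Fin (m + 2)) ℂ} {d : ℕ}

/-- **The lift read in the chart at `x₀` is analytic** at every point of the chart over `M_i`: it
is `ℂ`-differentiable there (the lift is holomorphic, `mdifferentiableOn_projLift`, and the
inverse chart is holomorphic), hence analytic by Osgood's lemma in several variables
(`Literature.Analysis.Complex.SCV.analyticAt_of_differentiableOn`, `E` finite-dimensional).
[folklore] -/
theorem analyticAt_projLift_comp_symm (hψ : Continuous ψ) (hhol : HasHolomorphicCoords E ψ)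
    (i : Fin (m + 2)) (x₀ : M) {y : E} (hy : y ∈ (extChartAt 𝓘(ℂ, E) x₀).target)
    (hyi : (extChartAt 𝓘(ℂ, E) x₀).symm y ∈ liftDomain ψ i) :
    AnalyticAt ℂ (projLift ψ i ∘ (extChartAt 𝓘(ℂ, E) x₀).symm) y := by
  set U := (extChartAt 𝓘(ℂ, E) x₀).target ∩ (extChartAt 𝓘(ℂ, E) x₀).symm ⁻¹' liftDomain ψ i with hU
  have hUo : IsOpen U :=
    (continuousOn_extChartAt_symm x₀).isOpen_inter_preimage (isOpen_extChartAt_target x₀)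
      (isOpen_liftDomain ψ hψ i)
  refine Literature.Analysis.Complex.SCV.analyticAt_of_differentiableOn ?_ hUo ⟨hy, hyi⟩
  intro y' hy'
  have h1 : MDifferentiableAt 𝓘(ℂ, E) 𝓘(ℂ, Fin (m + 2) → ℂ) (projLift ψ i)
      ((extChartAt 𝓘(ℂ, E) x₀).symm y') :=
    (mdifferentiableOn_projLift ψ hhol i _ hy'.2).mdifferentiableAt
      ((isOpen_liftDomain ψ hψ i).mem_nhds hy'.2)
  have h2 : MDifferentiableWithinAt 𝓘(ℂ, E) 𝓘(ℂ, E) (extChartAt 𝓘(ℂ, E) x₀).symm (range 𝓘(ℂ, E)) y' :=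
    mdifferentiableWithinAt_extChartAt_symm hy'.1
  have h3 := h1.comp_mdifferentiableWithinAt y' h2
  rw [ModelWithCorners.Boundaryless.range_eq_univ, mdifferentiableWithinAt_univ,
    mdifferentiableAt_iff_differentiableAt] at h3
  exact h3.differentiableWithinAt

/-- **Chain rule for the lift in the chart at `x₀`**: for `y` in the target of the chart at `x₀`
with `x = chart_{x₀}⁻¹(y) ∈ M_i`,
`dZ̃_i(x) ∘ (tangent coordinate change from the chart at x₀ to the chart at x) = D(Z̃_i ∘ chart_{x₀}⁻¹)(y)`
(`mvfderiv_eq_fderiv_comp_symm`, `hasFDerivWithinAt_tangentCoordChange`, `fderiv_comp`, and the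
two readings agree near `y`). [folklore] -/
theorem liftDeriv_comp_tangentCoordChange (hψ : Continuous ψ) (hhol : HasHolomorphicCoords E ψ)
    (i : Fin (m + 2)) (x₀ : M) {y : E} (hy : y ∈ (extChartAt 𝓘(ℂ, E) x₀).target)
    (hyi : (extChartAt 𝓘(ℂ, E) x₀).symm y ∈ liftDomain ψ i) :
    (liftDeriv ψ i ((extChartAt 𝓘(ℂ, E) x₀).symm y)).comp
        (tangentCoordChange 𝓘(ℂ, E) x₀ ((extChartAt 𝓘(ℂ, E) x₀).symm y)
          ((extChartAt 𝓘(ℂ, E) x₀).symm y)) =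
      fderiv ℂ (projLift ψ i ∘ (extChartAt 𝓘(ℂ, E) x₀).symm) y := by
  set x := (extChartAt 𝓘(ℂ, E) x₀).symm y with hx
  have hxs : x ∈ (extChartAt 𝓘(ℂ, E) x₀).source := (extChartAt 𝓘(ℂ, E) x₀).map_target hy
  have hyx : extChartAt 𝓘(ℂ, E) x₀ x = y := (extChartAt 𝓘(ℂ, E) x₀).right_inv hy
  have hmd : MDifferentiableAt 𝓘(ℂ, E) 𝓘(ℂ, Fin (m + 2) → ℂ) (projLift ψ i) x :=
    (mdifferentiableOn_projLift ψ hhol i x hyi).mdifferentiableAt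
      ((isOpen_liftDomain ψ hψ i).mem_nhds hyi)
  have hL := mvfderiv_eq_fderiv_comp_symm hmd
  rw [← liftDeriv_eq_mvfderiv] at hL
  set τ : E → E := extChartAt 𝓘(ℂ, E) x ∘ (extChartAt 𝓘(ℂ, E) x₀).symm with hτ
  have hT' : HasFDerivWithinAt τ (tangentCoordChange 𝓘(ℂ, E) x₀ x x) (range 𝓘(ℂ, E))
      (extChartAt 𝓘(ℂ, E) x₀ x) :=
    hasFDerivWithinAt_tangentCoordChange ⟨hxs, mem_extChartAt_source x⟩
  rw [ModelWithCorners.Boundaryless.range_eq_univ, hasFDerivWithinAt_univ, hyx] at hT'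
  set f₁ : E → Fin (m + 2) → ℂ := projLift ψ i ∘ (extChartAt 𝓘(ℂ, E) x).symm with hf₁
  have hτy : τ y = extChartAt 𝓘(ℂ, E) x x := by simp [hτ, hx]
  have hf₁d : DifferentiableAt ℂ f₁ (τ y) := by
    rw [hτy]
    exact (analyticAt_projLift_comp_symm ψ hψ hhol i x (mem_extChartAt_target x)
      (by simpa using hyi)).differentiableAt
  have hcomp : fderiv ℂ (f₁ ∘ τ) y = (fderiv ℂ f₁ (τ y)).comp (fderiv ℂ τ y) :=
    fderiv_comp y hf₁d hT'.differentiableAt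
  have hev : f₁ ∘ τ =ᶠ[𝓝 y] projLift ψ i ∘ (extChartAt 𝓘(ℂ, E) x₀).symm := by
    have hc : ContinuousAt (extChartAt 𝓘(ℂ, E) x₀).symm y := continuousAt_extChartAt_symm'' hy
    have hmem : (extChartAt 𝓘(ℂ, E) x).source ∈ 𝓝 ((extChartAt 𝓘(ℂ, E) x₀).symm y) :=
      extChartAt_source_mem_nhds (I := 𝓘(ℂ, E)) x
    filter_upwards [hc.preimage_mem_nhds hmem] with y' hy'
    simp only [hf₁, hτ, Function.comp_apply]
    rw [(extChartAt 𝓘(ℂ, E) x).left_inv hy']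
  rw [← hev.fderiv_eq, hcomp, hL, hτy, hT'.fderiv]

/-- **The residue form is holomorphic in charts.** Let `F` be homogeneous of degree `d ≥ m + 2`
with non-vanishing gradient at the non-zero zeros of `F`, `M` a complex manifold with holomorphic
atlas charted on the finite-dimensional `E`, `ψ : M → ℙ ℂ ℂ^{m+2}` continuous with image in the
projective zero locus of `F` and holomorphic affine coordinates, and `P` homogeneous of degree
`d - m - 2`. Then `residueForm ψ F P = ψ^* Res_Y(PΩ/F)` is holomorphic in charts: near the centre
of the chart at `x₀` its representative is `y ↦ P(Z y) · det(N(Z y), Z y, DZ(y) ·)` with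
`Z = Z̃_i ∘ chart_{x₀}⁻¹` (local formula `residueForm_eventuallyEq`, `MForm.inChart_eq_of_mem_target`,
`liftDeriv_comp_tangentCoordChange`, `Literature.Geometry.Kaehler.tangentCoordChange_eq_restrictScalars`),
an analytic function of `y` (`analyticAt_projLift_comp_symm`, `AnalyticAt.fderiv`, Mathlib's
`AnalyticOnNhd.eval_mvPolynomial`, `contDiffAt_coneResidue`). In print: `Res_Y(PΩ/F)` is a
holomorphic `(n-1)`-form on `Y` (Voisin II, §6.1.1). [cite: VoisinHodgeII2003, §6.1.1 and §6.1.3] -/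
theorem isHolomorphicInCharts_residueForm [IsManifold 𝓘(ℝ, E) ∞ M] (hF : F.IsHomogeneous d)
    (hψ : Continuous ψ)
    (hrange : Set.range ψ ⊆ projZeroLocus {F})
    (hjac : ∀ z : Fin (m + 2) → ℂ, z ≠ 0 → MvPolynomial.eval z F = 0 →
      ∃ j, MvPolynomial.eval z (MvPolynomial.pderiv j F) ≠ 0)
    (hhol : HasHolomorphicCoords E ψ)
    {P : MvPolynomial (Fin (m + 2)) ℂ} (hP : P.IsHomogeneous (d - (m + 2))) (hd : m + 2 ≤ d) :
    IsHolomorphicInCharts (residueForm (E := E) ψ F P) := by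
  intro x₀
  set i := residueIdx ψ x₀ with hidef
  have hi : x₀ ∈ liftDomain ψ i := residueIdx_spec ψ x₀
  obtain ⟨j, hj⟩ := hjac _ (projLift_ne_zero ψ i x₀) (eval_projLift_eq_zero ψ hF hrange hi)
  set Zc : E → Fin (m + 2) → ℂ := projLift ψ i ∘ (extChartAt 𝓘(ℂ, E) x₀).symm with hZc
  set g : E → E [⋀^Fin m]→L[ℂ] ℂ := fun y ↦ MvPolynomial.eval (Zc y) P •
    coneResidue (normalVec F (Zc y) j) (Zc y) (fderiv ℂ Zc y) with hg
  have hc₀ : extChartAt 𝓘(ℝ, E) x₀ x₀ = extChartAt 𝓘(ℂ, E) x₀ x₀ := rfl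
  have hZc₀ : Zc (extChartAt 𝓘(ℂ, E) x₀ x₀) = projLift ψ i x₀ := by simp [hZc]
  refine ⟨g, ?_, ?_⟩
  · -- analyticity of the representative
    rw [hc₀]
    have hZ : AnalyticAt ℂ Zc (extChartAt 𝓘(ℂ, E) x₀ x₀) :=
      analyticAt_projLift_comp_symm ψ hψ hhol i x₀ (mem_extChartAt_target x₀) (by simpa using hi)
    have hL : AnalyticAt ℂ (fderiv ℂ Zc) (extChartAt 𝓘(ℂ, E) x₀ x₀) := hZ.fderiv
    have hPz : AnalyticAt ℂ (fun y ↦ MvPolynomial.eval (Zc y) P) (extChartAt 𝓘(ℂ, E) x₀ x₀) :=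
      (AnalyticOnNhd.eval_mvPolynomial P _ (mem_univ _)).comp hZ
    have hN : AnalyticAt ℂ (fun y ↦ normalVec F (Zc y) j) (extChartAt 𝓘(ℂ, E) x₀ x₀) := by
      have h1 : AnalyticAt ℂ (fun y ↦ MvPolynomial.eval (Zc y) (MvPolynomial.pderiv j F))
          (extChartAt 𝓘(ℂ, E) x₀ x₀) := (AnalyticOnNhd.eval_mvPolynomial (MvPolynomial.pderiv j F) _ (mem_univ _)).comp hZ
      have h2 := h1.inv (by rw [hZc₀]; exact hj)
      exact h2.smul analyticAt_const
    have := hPz.contDiffAt.smul (contDiffAt_coneResidue (n := ω) hN.contDiffAt hZ.contDiffAt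
      hL.contDiffAt)
    exact this.analyticAt
  · -- the formula for the chart representative
    rw [hc₀]
    have htarget : ∀ᶠ y in 𝓝 (extChartAt 𝓘(ℂ, E) x₀ x₀), y ∈ (extChartAt 𝓘(ℂ, E) x₀).target :=
      extChartAt_target_mem_nhds x₀
    have hloc := residueForm_eventuallyEq ψ hF hψ hrange hjac hhol hP hd hi hj
    have hsymm : ContinuousAt (extChartAt 𝓘(ℂ, E) x₀).symm (extChartAt 𝓘(ℂ, E) x₀ x₀) :=
      continuousAt_extChartAt_symm x₀
    have hloc₀ : ∀ᶠ x in 𝓝 ((extChartAt 𝓘(ℂ, E) x₀).symm (extChartAt 𝓘(ℂ, E) x₀ x₀)),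
        residueForm ψ F P x =
          (show E [⋀^Fin m]→L[ℝ] ℂ from (residueFormula ψ F P i j x).restrictScalars ℝ) := by
      rw [extChartAt_to_inv]; exact hloc
    have hloc' := hsymm.tendsto.eventually hloc₀
    have hdom₀ : ∀ᶠ x in 𝓝 ((extChartAt 𝓘(ℂ, E) x₀).symm (extChartAt 𝓘(ℂ, E) x₀ x₀)),
        x ∈ liftDomain ψ i := by
      rw [extChartAt_to_inv]; exact (isOpen_liftDomain ψ hψ i).mem_nhds hi
    have hdom := hsymm.tendsto.eventually hdom₀
    filter_upwards [htarget, hloc', hdom] with y hy hyloc hyi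
    set x := (extChartAt 𝓘(ℂ, E) x₀).symm y with hx
    have hxs : x ∈ (chartAt E x₀).source := by
      have h' : x ∈ (extChartAt 𝓘(ℂ, E) x₀).source := (extChartAt 𝓘(ℂ, E) x₀).map_target hy
      rwa [extChartAt_source] at h'
    rw [MForm.inChart_eq_of_mem_target _ hy]
    change ((residueForm ψ F P x).compContinuousLinearMap (tangentCoordChange 𝓘(ℝ, E) x₀ x x) :
      E [⋀^Fin m]→L[ℝ] ℂ) = (g y).restrictScalars ℝ
    rw [hyloc, Literature.Geometry.Kaehler.tangentCoordChange_eq_restrictScalars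
      (by simp only [extChartAt_source]; exact ⟨hxs, mem_chart_source E x⟩)]
    change ((residueFormula ψ F P i j x).restrictScalars ℝ).compContinuousLinearMap
      ((tangentCoordChange 𝓘(ℂ, E) x₀ x x : E →L[ℂ] E).restrictScalars ℝ) = (g y).restrictScalars ℝ
    rw [← restrictScalars_compContinuousLinearMap]
    congr 1
    rw [residueFormula, smul_compContinuousLinearMap, ← coneResidue_comp,
      liftDeriv_comp_tangentCoordChange ψ hψ hhol i x₀ hy hyi]
    rfl

end Main

end Literature.AlgebraicGeometry.HodgeTheory

end
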